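import Summits.NavierStokesRegularity.NavierStokesRegularity.Theorems.TypeILiouvilleTypeIliouvilleLWeakL3HeatForm
import HarnessLib

/-!
# Two-level layer cake and mass on large balls for weak-`L³` functions with a controlled lower
# tail (crux `TypeIliouvilleL`, stmt-NavierStokesRegularity-10661, persistent stub S3ᵐ)

Helper file (theorems only, no definition, no named fact, no `sorry`; lands
`--supports stmt-NavierStokesRegularity-10661`). Measure-theoretic half of the discharge of
Albritton–Barker's blow-down condition (b) for weak-`L³` slices whose distribution function has a
vanishing lower tail (`…WeakL3VanishingTail`):

* `lintegral_ofReal_indicator_norm_le_of_weakL3_of_tail` — two-level layer cake: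
  `∫_{η<|f|}|f| ≤ 3d/(2η²) + M/(2s₁²)` if `s³vol{s<|f|} ≤ d` on `[η,s₁]` and `≤ M` everywhere;
* `setLIntegral_closedBall_enorm_le_of_weakL3_of_tail` — hence
  `∫_{B̄_Λ}|f| ≤ η Λ³ |B̄₁| + 3d/(2η²) + M/(2s₁²)`.

Nothing here proves S3ᵐ, (L), or anything about Navier–Stokes regularity.
-/

set_option linter.dupNamespace false

namespace Summit.NavierStokesRegularity.NavierStokesRegularity.Theorems

open MeasureTheory Filter Set Function Metric
open scoped ENNReal NNReal Topology RealInnerProductSpace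
open Literature.Analysis Literature.Analysis.FluidPDE

/-- **Two-level layer cake for the high part of a weak-`L³` function.** If `f` is a.e.-strongly
measurable on `ℝ³` with `s³ · vol{s < ‖f‖} ≤ M < ∞` for all `s > 0` and `≤ d` for
`s ∈ [η, s₁]` (`0 < η ≤ s₁`), then `∫_{η < ‖f‖} ‖f‖ ≤ 3d/(2η²) + M/(2s₁²)` (Cavalieri on
`(0,η] ∪ (η,s₁] ∪ (s₁,∞)`). [cite: Grafakos2014, proof of Thm 1.3.2 (splitting a weak-type function at a level)] -/
theorem lintegral_ofReal_indicator_norm_le_of_weakL3_of_tail {F : Type*} [NormedAddCommGroup F]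
    {f : EuclideanSpace ℝ (Fin 3) → F} (hf : AEStronglyMeasurable f volume)
    {M : ℝ≥0∞} (hM : M ≠ ∞)
    (hweak : ∀ s : ℝ, 0 < s →
      ENNReal.ofReal s ^ 3 * (volume : Measure (EuclideanSpace ℝ (Fin 3))) {x | s < ‖f x‖} ≤ M)
    {d η s₁ : ℝ} (hd : 0 ≤ d) (hη : 0 < η) (hηs : η ≤ s₁)
    (htail : ∀ s : ℝ, η ≤ s → s ≤ s₁ →
      ENNReal.ofReal s ^ 3 * (volume : Measure (EuclideanSpace ℝ (Fin 3))) {x | s < ‖f x‖} ≤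
        ENNReal.ofReal d) :
    ∫⁻ x, ENNReal.ofReal ((Ioi η).indicator id ‖f x‖) ≤
      ENNReal.ofReal (3 * d / (2 * η ^ 2) + M.toReal / (2 * s₁ ^ 2)) := by
  set m : ℝ := M.toReal with hm
  have hm0 : 0 ≤ m := ENNReal.toReal_nonneg
  have hs₁ : 0 < s₁ := hη.trans_le hηs
  set g : EuclideanSpace ℝ (Fin 3) → ℝ := fun x => (Ioi η).indicator id ‖f x‖ with hg
  have hg_nn : 0 ≤ᵐ[volume] g := Eventually.of_forall fun x => by
    simp only [hg, Pi.zero_apply]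
    by_cases hx : ‖f x‖ ∈ Ioi η
    · rw [indicator_of_mem hx]; exact norm_nonneg _
    · rw [indicator_of_notMem hx]
  have hg_meas : AEMeasurable g volume := by
    have h1 : Measurable fun r : ℝ => (Ioi η).indicator id r :=
      measurable_id.indicator measurableSet_Ioi
    exact h1.comp_aemeasurable hf.norm.aemeasurable
  have hsub : ∀ t : ℝ, 0 < t → {x | t < g x} ⊆ {x | max η t < ‖f x‖} := by
    intro t ht x hx
    simp only [mem_setOf_eq, hg] at hx ⊢
    by_cases hxm : ‖f x‖ ∈ Ioi η
    · rw [indicator_of_mem hxm] at hx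
      exact max_lt hxm hx
    · rw [indicator_of_notMem hxm] at hx
      exact absurd hx (not_lt.2 ht.le)
  -- distribution function of `g`: the global bound and the two-level bound
  have hdist : ∀ t : ℝ, 0 < t → ∀ {B : ℝ≥0∞} {b : ℝ}, B = ENNReal.ofReal b →
      ENNReal.ofReal (max η t) ^ 3 *
          (volume : Measure (EuclideanSpace ℝ (Fin 3))) {x | max η t < ‖f x‖} ≤ B →
      (volume : Measure (EuclideanSpace ℝ (Fin 3))) {x | t < g x} ≤
        ENNReal.ofReal (b / (max η t) ^ 3) := by
    intro t ht B b hB h1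
    have hs : 0 < max η t := lt_max_of_lt_left hη
    have hs3 : ENNReal.ofReal (max η t) ^ 3 ≠ 0 :=
      pow_ne_zero _ (ENNReal.ofReal_pos.2 hs).ne'
    have hs3' : ENNReal.ofReal (max η t) ^ 3 ≠ ∞ :=
      ENNReal.pow_ne_top ENNReal.ofReal_ne_top
    calc (volume : Measure (EuclideanSpace ℝ (Fin 3))) {x | t < g x}
        ≤ volume {x | max η t < ‖f x‖} := measure_mono (hsub t ht)
      _ ≤ B / ENNReal.ofReal (max η t) ^ 3 := by
          rw [ENNReal.le_div_iff_mul_le (Or.inl hs3) (Or.inl hs3'), mul_comm]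
          exact h1
      _ = ENNReal.ofReal (b / (max η t) ^ 3) := by
          rw [hB, ENNReal.ofReal_div_of_pos (pow_pos hs 3), ENNReal.ofReal_pow hs.le]
  have hMm : M = ENNReal.ofReal m := by rw [hm, ENNReal.ofReal_toReal hM]
  -- Cavalieri
  rw [lintegral_eq_lintegral_meas_lt volume hg_nn hg_meas]
  have hsplit : Ioi (0 : ℝ) ⊆ (Ioc 0 η ∪ Ioc η s₁) ∪ Ioi s₁ := by
    intro t ht
    rcases le_or_gt t η with h | h
    · exact Or.inl (Or.inl ⟨ht, h⟩)
    · rcases le_or_gt t s₁ with h' | h'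
      · exact Or.inl (Or.inr ⟨h, h'⟩)
      · exact Or.inr h'
  -- (0, η]
  have h1 : ∫⁻ t in Ioc (0 : ℝ) η, (volume : Measure (EuclideanSpace ℝ (Fin 3))) {x | t < g x}
      ≤ ENNReal.ofReal (d / η ^ 2) := by
    calc ∫⁻ t in Ioc (0 : ℝ) η, (volume : Measure (EuclideanSpace ℝ (Fin 3))) {x | t < g x}
        ≤ ∫⁻ _ in Ioc (0 : ℝ) η, ENNReal.ofReal (d / η ^ 3) := by
          refine setLIntegral_mono' measurableSet_Ioc fun t ht => ?_
          have hmax : max η t = η := max_eq_left ht.2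
          have h := hdist t ht.1 rfl (by rw [hmax]; exact htail η le_rfl hηs)
          rwa [hmax] at h
      _ = ENNReal.ofReal (d / η ^ 3) * volume (Ioc (0 : ℝ) η) := setLIntegral_const _ _
      _ = ENNReal.ofReal (d / η ^ 2) := by
          rw [Real.volume_Ioc, sub_zero, ← ENNReal.ofReal_mul (by positivity)]
          congr 1
          field_simp
  -- (η, s₁]
  have h2 : ∫⁻ t in Ioc η s₁, (volume : Measure (EuclideanSpace ℝ (Fin 3))) {x | t < g x}
      ≤ ENNReal.ofReal (d / (2 * η ^ 2)) := by
    have hint : IntegrableOn (fun t : ℝ => d * t ^ (-3 : ℝ)) (Ioi η) volume :=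
      (integrableOn_Ioi_rpow_of_lt (by norm_num) hη).const_mul d
    calc ∫⁻ t in Ioc η s₁, (volume : Measure (EuclideanSpace ℝ (Fin 3))) {x | t < g x}
        ≤ ∫⁻ t in Ioc η s₁, ENNReal.ofReal (d * t ^ (-3 : ℝ)) := by
          refine setLIntegral_mono' measurableSet_Ioc fun t ht => ?_
          have ht0 : 0 < t := hη.trans ht.1
          have hmax : max η t = t := max_eq_right (le_of_lt ht.1)
          have h := hdist t ht0 rfl (by rw [hmax]; exact htail t (le_of_lt ht.1) ht.2)
          rw [hmax] at h
          refine h.trans (le_of_eq ?_)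
          congr 1
          rw [Real.rpow_neg ht0.le, div_eq_mul_inv]
          norm_cast
      _ ≤ ∫⁻ t in Ioi η, ENNReal.ofReal (d * t ^ (-3 : ℝ)) := lintegral_mono_set Ioc_subset_Ioi_self
      _ = ENNReal.ofReal (∫ t in Ioi η, d * t ^ (-3 : ℝ)) := by
          rw [ofReal_integral_eq_lintegral_ofReal hint]
          refine (ae_restrict_iff' measurableSet_Ioi).2 (Eventually.of_forall fun t ht => ?_)
          exact mul_nonneg hd (Real.rpow_nonneg (hη.trans ht).le _)
      _ = ENNReal.ofReal (d / (2 * η ^ 2)) := by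
          rw [integral_const_mul, integral_Ioi_rpow_of_lt (by norm_num) hη]
          congr 1
          have h2 : η ^ (-3 + 1 : ℝ) = (η ^ 2)⁻¹ := by
            rw [show (-3 + 1 : ℝ) = -2 by norm_num, Real.rpow_neg hη.le]
            norm_cast
          rw [h2]
          field_simp
          ring
  -- (s₁, ∞)
  have h3 : ∫⁻ t in Ioi s₁, (volume : Measure (EuclideanSpace ℝ (Fin 3))) {x | t < g x}
      ≤ ENNReal.ofReal (m / (2 * s₁ ^ 2)) := by
    have hint : IntegrableOn (fun t : ℝ => m * t ^ (-3 : ℝ)) (Ioi s₁) volume :=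
      (integrableOn_Ioi_rpow_of_lt (by norm_num) hs₁).const_mul m
    calc ∫⁻ t in Ioi s₁, (volume : Measure (EuclideanSpace ℝ (Fin 3))) {x | t < g x}
        ≤ ∫⁻ t in Ioi s₁, ENNReal.ofReal (m * t ^ (-3 : ℝ)) := by
          refine setLIntegral_mono' measurableSet_Ioi fun t ht => ?_
          have ht0 : 0 < t := hs₁.trans ht
          have hmax : max η t = t := max_eq_right (hηs.trans (le_of_lt ht))
          have h := hdist t ht0 hMm (by rw [hmax]; exact hweak t ht0)
          rw [hmax] at h
          refine h.trans (le_of_eq ?_)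
          congr 1
          rw [Real.rpow_neg ht0.le, div_eq_mul_inv]
          norm_cast
      _ = ENNReal.ofReal (∫ t in Ioi s₁, m * t ^ (-3 : ℝ)) := by
          rw [ofReal_integral_eq_lintegral_ofReal hint]
          refine (ae_restrict_iff' measurableSet_Ioi).2 (Eventually.of_forall fun t ht => ?_)
          exact mul_nonneg hm0 (Real.rpow_nonneg (hs₁.trans ht).le _)
      _ = ENNReal.ofReal (m / (2 * s₁ ^ 2)) := by
          rw [integral_const_mul, integral_Ioi_rpow_of_lt (by norm_num) hs₁]
          congr 1
          have h2 : s₁ ^ (-3 + 1 : ℝ) = (s₁ ^ 2)⁻¹ := by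
            rw [show (-3 + 1 : ℝ) = -2 by norm_num, Real.rpow_neg hs₁.le]
            norm_cast
          rw [h2]
          field_simp
          ring
  calc ∫⁻ t in Ioi (0 : ℝ), (volume : Measure (EuclideanSpace ℝ (Fin 3))) {x | t < g x}
      ≤ ∫⁻ t in (Ioc (0 : ℝ) η ∪ Ioc η s₁) ∪ Ioi s₁,
          (volume : Measure (EuclideanSpace ℝ (Fin 3))) {x | t < g x} := lintegral_mono_set hsplit
    _ ≤ (∫⁻ t in Ioc (0 : ℝ) η ∪ Ioc η s₁, (volume : Measure (EuclideanSpace ℝ (Fin 3))) {x | t < g x}) +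
          ∫⁻ t in Ioi s₁, (volume : Measure (EuclideanSpace ℝ (Fin 3))) {x | t < g x} :=
        lintegral_union_le _ _ _
    _ ≤ ((∫⁻ t in Ioc (0 : ℝ) η, (volume : Measure (EuclideanSpace ℝ (Fin 3))) {x | t < g x}) +
          ∫⁻ t in Ioc η s₁, (volume : Measure (EuclideanSpace ℝ (Fin 3))) {x | t < g x}) +
          ∫⁻ t in Ioi s₁, (volume : Measure (EuclideanSpace ℝ (Fin 3))) {x | t < g x} :=
        add_le_add (lintegral_union_le _ _ _) le_rfl
    _ ≤ (ENNReal.ofReal (d / η ^ 2) + ENNReal.ofReal (d / (2 * η ^ 2))) +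
          ENNReal.ofReal (m / (2 * s₁ ^ 2)) := add_le_add (add_le_add h1 h2) h3
    _ = ENNReal.ofReal (3 * d / (2 * η ^ 2) + m / (2 * s₁ ^ 2)) := by
        rw [← ENNReal.ofReal_add (by positivity) (by positivity),
          ← ENNReal.ofReal_add (by positivity) (by positivity)]
        congr 1
        field_simp
        ring

/-- **Mass of a weak-`L³` function on a large ball.** Under the hypotheses of
`lintegral_ofReal_indicator_norm_le_of_weakL3_of_tail`, for every `Λ ≥ 0`:
`∫_{B̄(0,Λ)} ‖f‖ ≤ η Λ³ vol(B̄₁) + 3d/(2η²) + M/(2s₁²)` (split `‖f‖ ≤ η + ‖f‖𝟙_{η<‖f‖}` on the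
ball). [folklore] -/
theorem setLIntegral_closedBall_enorm_le_of_weakL3_of_tail {F : Type*} [NormedAddCommGroup F]
    {f : EuclideanSpace ℝ (Fin 3) → F} (hf : AEStronglyMeasurable f volume)
    {M : ℝ≥0∞} (hM : M ≠ ∞)
    (hweak : ∀ s : ℝ, 0 < s →
      ENNReal.ofReal s ^ 3 * (volume : Measure (EuclideanSpace ℝ (Fin 3))) {x | s < ‖f x‖} ≤ M)
    {d η s₁ : ℝ} (hd : 0 ≤ d) (hη : 0 < η) (hηs : η ≤ s₁)
    (htail : ∀ s : ℝ, η ≤ s → s ≤ s₁ →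
      ENNReal.ofReal s ^ 3 * (volume : Measure (EuclideanSpace ℝ (Fin 3))) {x | s < ‖f x‖} ≤
        ENNReal.ofReal d)
    {Λ : ℝ} (hΛ : 0 ≤ Λ) :
    ∫⁻ x in closedBall (0 : EuclideanSpace ℝ (Fin 3)) Λ, ‖f x‖ₑ ≤
      ENNReal.ofReal (η * Λ ^ 3 *
          ((volume : Measure (EuclideanSpace ℝ (Fin 3))) (closedBall 0 1)).toReal +
        (3 * d / (2 * η ^ 2) + M.toReal / (2 * s₁ ^ 2))) := by
  set g : EuclideanSpace ℝ (Fin 3) → ℝ := fun x => (Ioi η).indicator id ‖f x‖ with hg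
  have hg0 : ∀ z, 0 ≤ g z := fun z => by
    simp only [hg]
    by_cases hz : ‖f z‖ ∈ Ioi η
    · rw [indicator_of_mem hz]; exact norm_nonneg _
    · rw [indicator_of_notMem hz]
  have hsplit : ∀ z, ‖f z‖ₑ ≤ ENNReal.ofReal η + ENNReal.ofReal (g z) := by
    intro z
    rw [← ofReal_norm]
    by_cases hz : ‖f z‖ ∈ Ioi η
    · simp only [hg, indicator_of_mem hz, id]
      exact le_add_self
    · have hle : ‖f z‖ ≤ η := not_lt.1 hz
      exact (ENNReal.ofReal_le_ofReal hle).trans le_self_add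
  have hV : (volume : Measure (EuclideanSpace ℝ (Fin 3))) (closedBall 0 1) ≠ ∞ :=
    measure_closedBall_lt_top.ne
  have hball : (volume : Measure (EuclideanSpace ℝ (Fin 3))) (closedBall 0 Λ) =
      ENNReal.ofReal (Λ ^ 3) * volume (closedBall (0 : EuclideanSpace ℝ (Fin 3)) 1) := by
    rw [Measure.addHaar_closedBall' volume (0 : EuclideanSpace ℝ (Fin 3)) hΛ, finrank_euclideanSpace_fin]
  calc ∫⁻ x in closedBall (0 : EuclideanSpace ℝ (Fin 3)) Λ, ‖f x‖ₑ
      ≤ ∫⁻ x in closedBall (0 : EuclideanSpace ℝ (Fin 3)) Λ, (ENNReal.ofReal η + ENNReal.ofReal (g x)) :=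
        lintegral_mono fun x => hsplit x
    _ = (∫⁻ _ in closedBall (0 : EuclideanSpace ℝ (Fin 3)) Λ, ENNReal.ofReal η) +
          ∫⁻ x in closedBall (0 : EuclideanSpace ℝ (Fin 3)) Λ, ENNReal.ofReal (g x) :=
        lintegral_add_left measurable_const _
    _ ≤ ENNReal.ofReal η * volume (closedBall (0 : EuclideanSpace ℝ (Fin 3)) Λ) +
          ∫⁻ x, ENNReal.ofReal (g x) := by
        rw [setLIntegral_const]
        exact add_le_add le_rfl (setLIntegral_le_lintegral _ _)
    _ ≤ ENNReal.ofReal η * volume (closedBall (0 : EuclideanSpace ℝ (Fin 3)) Λ) +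
          ENNReal.ofReal (3 * d / (2 * η ^ 2) + M.toReal / (2 * s₁ ^ 2)) :=
        add_le_add le_rfl
          (lintegral_ofReal_indicator_norm_le_of_weakL3_of_tail hf hM hweak hd hη hηs htail)
    _ = _ := by
        rw [hball]
        have e1 : ENNReal.ofReal (η * Λ ^ 3 *
              ((volume : Measure (EuclideanSpace ℝ (Fin 3))) (closedBall 0 1)).toReal +
            (3 * d / (2 * η ^ 2) + M.toReal / (2 * s₁ ^ 2))) =
            ENNReal.ofReal η * (ENNReal.ofReal (Λ ^ 3) *
                (volume : Measure (EuclideanSpace ℝ (Fin 3))) (closedBall 0 1)) +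
              ENNReal.ofReal (3 * d / (2 * η ^ 2) + M.toReal / (2 * s₁ ^ 2)) := by
          rw [ENNReal.ofReal_add (by positivity) (by positivity),
            ENNReal.ofReal_mul (p := η * Λ ^ 3) (by positivity), ENNReal.ofReal_mul (p := η) hη.le,
            ENNReal.ofReal_toReal hV, mul_assoc]
        rw [e1]

end Summit.NavierStokesRegularity.NavierStokesRegularity.Theorems
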